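import Summits.ResolutionOfSingularities.ResolutionOfSingularities.Theorems.FrobeniusLadderFRationalResolutionFRationalCM
import Summits.ResolutionOfSingularities.ResolutionOfSingularities.Theorems.FrobeniusLadderFRationalResolutionStalkPresentationRegular
import Summits.ResolutionOfSingularities.ResolutionOfSingularities.Theorems.FrobeniusLadderFRationalResolutionStubClauseOfRingEquiv
import HarnessLib

/-!
# F-rational ⇒ Cohen–Macaulay at the stalks of `k`-schemes locally of finite type

Route `FrobeniusLadder`, crux stmt-ResolutionOfSingularities-15317 `FRationalResolution`, line
`Sketch`, stub `isWeaklyRegular_sop_stalk_of_fRational_clause` (Hochster–Huneke 1994, Thm. 4.2 (c),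
at the level of STALKS). Let `k` be a field of characteristic `p`, `f : X → Spec k` locally of
finite type and `x ∈ X` a point whose stalk `𝒪_{X,x}` satisfies the F-rational clause of the crux
(a domain all of whose parameter ideals are tightly closed, inline form). Then every system of
parameters `s` of `𝒪_{X,x}` (`d = dim 𝒪_{X,x}` elements generating an ideal with maximal radical) is
a weakly regular sequence.

Proof. Present the stalk as `e : 𝒪_{X,x} ≃+* S ⧸ Q` with `S` regular local of characteristic `p`
and `Q` prime (`exists_stalk_ringEquiv_regularLocal_quotient`); transport the clause along `e`
(`ClauseInvariance.stub_clause_of_ringEquiv`) and the system of parameters (`e ∘ s` generates the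
`e.symm`-preimage of `(s)`, `ClauseInvariance.span_range_symm_comp`); apply the ring-level theorem
`isWeaklyRegular_of_fRational_clause_quotient` in `S ⧸ Q`; and pull weak regularity of the list
`List.ofFn (e ∘ s) = (List.ofFn s).map e` back along the additive equivalence underlying `e`
(`AddEquiv.isWeaklyRegular_congr`).
-/

-- single-problem summit: the doubled namespace component `ResolutionOfSingularities` is forced
set_option linter.dupNamespace false

noncomputable section

namespace Summit.ResolutionOfSingularities.ResolutionOfSingularities.Theorems.FRationalResolution

open CategoryTheory AlgebraicGeometry TopologicalSpace

/-- Weak regularity of a list transports along a ring isomorphism `e : R ≃+* T` (each ring a module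
over itself): `rs` is weakly regular on `R` iff `rs.map e` is weakly regular on `T`. -/
theorem isWeaklyRegular_map_ringEquiv_iff {R T : Type} [CommRing R] [CommRing T] (e : R ≃+* T)
    (rs : List R) :
    RingTheory.Sequence.IsWeaklyRegular T (rs.map e) ↔
      RingTheory.Sequence.IsWeaklyRegular R rs := by
  refine (AddEquiv.isWeaklyRegular_congr (e := e.toAddEquiv) ?_).symm
  exact List.forall₂_map_right_iff.mpr (List.forall₂_same.mpr fun r _ y => map_mul e r y)

/-- **F-rational ⇒ Cohen–Macaulay at the stalks** (Hochster–Huneke 1994, Thm. 4.2 (c)). For a field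
`k` of characteristic `p`, `f : X → Spec k` locally of finite type and a point `x ∈ X` whose stalk
satisfies the F-rational clause of crux `FRationalResolution` (a domain all of whose ideals
generated by a system of parameters are tightly closed, inline form), every system of parameters
`s` of `𝒪_{X,x}` is a weakly regular sequence on `𝒪_{X,x}`. -/
theorem isWeaklyRegular_sop_stalk_of_fRational_clause (p : ℕ) (hp : p.Prime) (k : Type) [Field k]
    [CharP k p] (X : Scheme.{0}) (f : X ⟶ Spec (.of k)) [LocallyOfFiniteType f] (x : X)
    (hFR : IsDomain (X.presheaf.stalk x) ∧ ∀ d : ℕ, ringKrullDim (X.presheaf.stalk x) = d →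
      ∀ s : Fin d → X.presheaf.stalk x, (Ideal.span (Set.range s)).radical.IsMaximal →
      ∀ y c : X.presheaf.stalk x, c ≠ 0 →
      (∀ e : ℕ, c * y ^ p ^ e ∈ Ideal.span ((fun z : X.presheaf.stalk x => z ^ p ^ e) ''
        (Ideal.span (Set.range s) : Set (X.presheaf.stalk x)))) → y ∈ Ideal.span (Set.range s))
    {d : ℕ} (hd : ringKrullDim (X.presheaf.stalk x) = d) (s : Fin d → X.presheaf.stalk x)
    (hs : (Ideal.span (Set.range s)).radical.IsMaximal) :
    RingTheory.Sequence.IsWeaklyRegular (X.presheaf.stalk x) (List.ofFn s) := by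
  haveI : IsDomain (X.presheaf.stalk x) := hFR.1
  haveI : Fact p.Prime := ⟨hp⟩
  -- the presentation `e : 𝒪_{X,x} ≃+* S ⧸ Q`, `S` regular local of characteristic `p`, `Q` prime
  obtain ⟨S, _, _, _, Q, hQ, ⟨e⟩⟩ := exists_stalk_ringEquiv_regularLocal_quotient hp k X f x
  haveI := hQ
  -- the clause, the dimension and the system of parameters, transported along `e`
  have hT := (ClauseInvariance.stub_clause_of_ringEquiv p e hFR).2
  have hdT : ringKrullDim (S ⧸ Q) = d := (ringKrullDim_eq_of_ringEquiv e).symm.trans hd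
  have hJ : Ideal.span (Set.range (e ∘ s)) = (Ideal.span (Set.range s)).comap e.symm := by
    have h := ClauseInvariance.span_range_symm_comp e.symm s
    rwa [RingEquiv.symm_symm] at h
  have hsT : (Ideal.span (Set.range (e ∘ s))).radical.IsMaximal := by
    haveI := hs
    rw [hJ, ← Ideal.comap_radical]
    exact Ideal.comap_isMaximal_of_equiv e.symm
  -- HH94 Thm. 4.2 (c) in `S ⧸ Q`, then back along `e`
  have hW := isWeaklyRegular_of_fRational_clause_quotient p S Q hT hdT (e ∘ s) hsT
  rw [← List.map_ofFn] at hW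
  exact (isWeaklyRegular_map_ringEquiv_iff e (List.ofFn s)).mp hW

end Summit.ResolutionOfSingularities.ResolutionOfSingularities.Theorems.FRationalResolution

end
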